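/-
Copyright (c) 2026 the pub-hodgecm-mathlib formalisation cell (harness21).  Prover seat hodgecm-mathlib-LH4-p08 (g11) (valve hand), Track B «K2-LIT»,
#184♮ = hLiu418 = `stmt-HodgeConjecture-24832`; socket #41, KIND W, (x-b) side — LEAD F0P6-plan (g14) BATCH #88 (4) VALVE DEAL 2026-09-04T22:34:17Z
«KIND-W FILE 2b: arch block currency ⟹ (D-loc)», desk K2E4-p10 (g9); LEAD BATCH #93 (2) «hypothesis-first on the ★ (x-b) heads, never on the unwritten ∃-head».
THEOREMS ONLY (no `def`, no `instance`, no notation, no named-fact hypothesis, no `sorry`).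
-/
import Summits.HodgeConjecture.HodgeConjecture.Theorems.K2LiuSiegelEisensteinKindWArchDecay     -- ★ (x-b) the pointwise decay face (+ ★ G7-C, G7-B, G7-A through it)
import HarnessLib

/-!
# Crux `HLiu418`, socket #41, KIND W — `K2LiuSiegelEisensteinKindWArchBlock`: THE THREE-FACTOR ARCHIMEDEAN GROWTH IN BLOCK CURRENCY ⟹ THE (D-loc) SHAPE

Cell `hodgecm-mathlib`, crux item hLiu418 = `stmt-HodgeConjecture-24832` (helper lane `--supports … --as helper`, count-neutral), route of record `HCCMUnconditional`;
squad K2 ∕ K2Liu, road `K2_Liu`, socket #41 `sig_K2LiuSiegelEisensteinContinuation`, KIND W.  The TOP's decay letter `hdec` is assembled by ★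
`K2LiuSiegelEisensteinKindWDecay.hdec_of_letters` from a LOCAL decay letter `hloc` of the shape («(D-loc)», constants locally uniform in `s`)
  `‖A i s x‖ ≤ C · ‖x‖^a · (e^{−c ‖x‖^{−a′} τ i} · (1 + τ i)^{N₁}) · ∏_{w ∣ ∞} (1 + |det (mat i)|_w⁻¹)^{N′}`.
Its archimedean source is the THREE-FACTOR growth of the continued local Whittaker function of a `K_w`-finite flat section (★ JUNCTION
`K2LiuKFiniteSectionWhittakerHolomorphyGrowth.kFiniteSection_whittaker_holomorphy_growth`): `C e^{−cg·tr h′} (1 + tr h′)^{Ng} (1 + det h′^{−N′g})` (real exponents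
`Ng, N′g ≥ 0`), read at the point through the Iwasawa block `y_σ` of ★ G7 (`K2LiuIwasawaHeightLatticeSumBound`): `h′_σ = y_σᴴ x_σ y_σ`, so `tr h′_σ = Re tr(x_σ · y_σ y_σᴴ)`
and `det h′_σ = Re det(x_σ · y_σ y_σᴴ) = Re det x_σ · ‖det y_σ‖²` (§1).  THIS FILE converts the product over the block places `σ` of the three factors into the
(D-loc) shape in the HEIGHT currency, BY VALUE over the ★ G7 frame (complex places `w σ` fixed by `c ≠ 1`, `r : p ⊕ p ≃ Fin N`, frames `T σ, T σ⁻¹`, movers, one bound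
`M ≥ 1`, ANY block decomposition `hdec : T σ · (h_∞)~_{w σ} · T σ⁻¹ = [y σ, b σ; 0, d σ] · κ σ`):
* §1 block algebra of the index at the point: `trace∕det (yᴴ x y) = trace∕det (x · y yᴴ)`, the UPPER trace comparison **`re_trace_mul_le_of_entry_le`**
  `Re tr(x · y yᴴ) ≤ |p|³ R² · Re tr x` (`x ≻ 0`, entries of `y` below `R`; ★ G7-B `norm_apply_le_re_trace_of_posDef`, `norm_mul_apply_le`), the det split
  `re_det_mul_mul_conjTranspose`, `Re det x > 0`;
* §2 real bookkeeping: `1 + (uv)^{−N} ≤ (1 + u^{−N})(1 + v^{−N})`, and the ℝ → ℕ exponent steps `1 + u^{−N} ≤ 2 (1 + u⁻¹)^{N′}`, `(1 + t)^{N} ≤ (1 + t)^{N₁}`;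
* §3 **`archGrowth_le_heightDecay`** — THE FACE: `∃ C a c₁` (frame + growth data only) with, for every `h`, every block decomposition, every index `x : S → M_p(ℂ)`,
  all `x σ ≻ 0`, and every size `τ` with `τ ≤ Σ_σ Re tr x_σ ≤ K τ`:
  `∏_σ e^{−cg Re tr(x_σ y_σ y_σᴴ)} (1 + Re tr(x_σ y_σ y_σᴴ))^{Ng} (1 + (Re det(x_σ y_σ y_σᴴ))^{−N′g}) ≤ C ‖h‖^a (e^{−c₁ ‖h‖^{−2} τ} (1 + τ)^{N₁}) ∏_σ (1 + (Re det x_σ)⁻¹)^{N′₁}`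
  — the bytes of `hloc`'s right-hand side with `a′ = 2`, the determinant DEFECT left in block currency over the block places (the dictionary
  `(Re det x_σ)⁻¹ ↔ |det S|_{w σ}⁻¹` and the two-sided comparison of the TOP's `τ S` with `Σ_σ Re tr x_σ` belong to the junction of (x-a)∕(x-b), not assumed here).
  Factor (i) is ★ `K2LiuSiegelEisensteinKindWArchDecay.decay_le_exp_neg_height`'s road at a general rate `cg` (`y yᴴ ⪰ ε(h)•1`, `ε(h)⁻¹ ≤ c_E² ‖h‖²`, ★ G7-A
  `mul_re_trace_le_re_trace_mul`); factor (ii) is §1 + ★ `block_entry_bounds` (`1 + tr h′_σ ≤ K₂ ‖h‖² (1 + Σ_σ Re tr x_σ)`); factor (iii) is §1 + ★ `rpow_neg_re_det_le`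
  (`(‖det y_σ‖²)^{−N′g} ≤ K₃ ‖h‖^{2|p|N′g}`) + §2, with the height floor ★ `exists_adelicHeightGL_floor` absorbing the `1 +`.
[MoeglinWaldspurger1995, I.2.2, II.1.5, II.1.7], [BorelJacquet1979, §1.2, §4.1], [Shimura1997, §A3, §18.4].
HONEST LABEL.  Count-neutral helper, closes no socket: `HC_CM` is proved only modulo the 7 printed citations (2 remaining named inputs: hLiu418 =
`stmt-HodgeConjecture-24832`, h413 = `stmt-HodgeConjecture-24833`) until rung 0 closes.
-/

set_option autoImplicit false
set_option linter.dupNamespace false -- the mandated namespace repeats `HodgeConjecture.HodgeConjecture`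

noncomputable section

open scoped BigOperators ComplexOrder Matrix
-- `Classical` is needed to see the Mathlib normed-ring instances on `mixedSpace E` (note H5 of `AdelicGLnGlue`)
open scoped Classical
open Finset

namespace Summit.HodgeConjecture.HodgeConjecture.Cruxes.HLiu418.K2LiuSiegelEisensteinKindWArchBlock

open Summit.HodgeConjecture.HodgeConjecture.Cruxes.HLiu418.K2LiuArchBlockHeightBound
open Summit.HodgeConjecture.HodgeConjecture.Cruxes.HLiu418.K2LiuLatticeExpDecaySumBound (mul_re_trace_le_re_trace_mul re_trace_mul_nonneg)
open Summit.HodgeConjecture.HodgeConjecture.Cruxes.HLiu418.K2LiuIwasawaHeightLatticeSumBound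
open Summit.HodgeConjecture.HodgeConjecture.Cruxes.HLiu418.K2LiuSiegelEisensteinKindWArchDecay (re_trace_nonneg_of_posSemidef)

/-! ## §1 Block algebra of the index at the point -/

section Block

variable {p : Type*} [Fintype p] [DecidableEq p]

omit [DecidableEq p] in
/-- the Iwasawa-normalised index `h′ = yᴴ x y` has the trace of `x · y yᴴ`. [folklore] -/
theorem trace_conjTranspose_mul_mul_eq (x y : Matrix p p ℂ) : (yᴴ * x * y).trace = (x * (y * yᴴ)).trace := by
  rw [Matrix.trace_mul_cycle, Matrix.trace_mul_comm]

/-- … and the determinant of `x · y yᴴ`. [folklore] -/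
theorem det_conjTranspose_mul_mul_eq (x y : Matrix p p ℂ) : (yᴴ * x * y).det = (x * (y * yᴴ)).det := by
  rw [Matrix.det_mul, Matrix.det_mul, Matrix.det_mul, Matrix.det_mul]
  ring

/-- **the polynomial factor in block currency**: for `x ≻ 0` and a block `y` with entries `≤ R` (`R ≥ 0`),
`Re tr(x · y yᴴ) ≤ |p|³ R² · Re tr x` (entries of `x ≻ 0` are below its trace, ★ G7-B `norm_apply_le_re_trace_of_posDef`; entries of products, ★ G7-B
`norm_mul_apply_le`). [folklore] -/
theorem re_trace_mul_le_of_entry_le {x y : Matrix p p ℂ} (hx : x.PosDef) {R : ℝ} (hR : 0 ≤ R) (hy : ∀ i j, ‖y i j‖ ≤ R) :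
    ((x * (y * yᴴ)).trace).re ≤ (Fintype.card p : ℝ) ^ 3 * R ^ 2 * (x.trace).re := by
  have ht : ∀ i j, ‖x i j‖ ≤ (x.trace).re := norm_apply_le_re_trace_of_posDef hx
  have ht0 : 0 ≤ (x.trace).re := re_trace_nonneg_of_posSemidef hx.posSemidef
  have hyH : ∀ i j, ‖yᴴ i j‖ ≤ R := fun i j => by rw [Matrix.conjTranspose_apply, norm_star]; exact hy j i
  have hY : ∀ i j, ‖(y * yᴴ) i j‖ ≤ Fintype.card p * (R * R) := norm_mul_apply_le hR hy hyH
  have hXY : ∀ i j, ‖(x * (y * yᴴ)) i j‖ ≤ Fintype.card p * ((x.trace).re * (Fintype.card p * (R * R))) := norm_mul_apply_le ht0 ht hY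
  rw [re_trace_eq_sum]
  calc ∑ k, ((x * (y * yᴴ)) k k).re ≤ ∑ k, ‖(x * (y * yᴴ)) k k‖ :=
        Finset.sum_le_sum fun k _ => (le_abs_self _).trans (Complex.abs_re_le_norm _)
    _ ≤ ∑ _k : p, (Fintype.card p : ℝ) * ((x.trace).re * (Fintype.card p * (R * R))) := Finset.sum_le_sum fun k _ => hXY k k
    _ = (Fintype.card p : ℝ) ^ 3 * R ^ 2 * (x.trace).re := by rw [Finset.sum_const, Finset.card_univ, nsmul_eq_mul]; ring

/-- **the determinant splits**: `Re det(x · y yᴴ) = Re det x · ‖det y‖²` (`det (y yᴴ) = ‖det y‖²` is real). [folklore] -/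
theorem re_det_mul_mul_conjTranspose (x y : Matrix p p ℂ) : ((x * (y * yᴴ)).det).re = (x.det).re * ‖y.det‖ ^ 2 := by
  have hY : (y * yᴴ).det = ((‖y.det‖ ^ 2 : ℝ) : ℂ) := by
    rw [Matrix.det_mul, Matrix.det_conjTranspose, Complex.star_def, Complex.mul_conj', Complex.ofReal_pow]
  rw [Matrix.det_mul, hY, Complex.mul_re, Complex.ofReal_re, Complex.ofReal_im, mul_zero, sub_zero]

/-- the determinant of a positive definite complex matrix is a positive real. [folklore] -/
theorem re_det_pos_of_posDef {x : Matrix p p ℂ} (hx : x.PosDef) : 0 < (x.det).re ∧ (x.det).im = 0 := by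
  have h := Complex.pos_iff.1 hx.det_pos
  exact ⟨h.1, h.2.symm⟩

end Block

/-! ## §2 Real bookkeeping -/

section Real

/-- `1 + (u v)^{−N} ≤ (1 + u^{−N}) (1 + v^{−N})` for `u, v ≥ 0`. [folklore] -/
theorem one_add_mul_rpow_neg_le_mul {u v : ℝ} (hu : 0 ≤ u) (hv : 0 ≤ v) (N : ℝ) :
    1 + (u * v) ^ (-N) ≤ (1 + u ^ (-N)) * (1 + v ^ (-N)) := by
  rw [Real.mul_rpow hu hv]
  have ha : 0 ≤ u ^ (-N) := Real.rpow_nonneg hu _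
  have hb : 0 ≤ v ^ (-N) := Real.rpow_nonneg hv _
  nlinarith [mul_nonneg ha hb]

/-- real exponent → natural exponent on the determinant defect: `1 + u^{−N} ≤ 2 (1 + u⁻¹)^{N′}` for `u > 0`, `0 ≤ N ≤ N′`. [folklore] -/
theorem one_add_rpow_neg_le_two_mul_pow {u N : ℝ} (hu : 0 < u) (hN : 0 ≤ N) {N' : ℕ} (hN' : N ≤ N') :
    1 + u ^ (-N) ≤ 2 * (1 + u⁻¹) ^ N' := by
  have hui0 : 0 ≤ u⁻¹ := inv_nonneg.2 hu.le
  have h1 : (1 : ℝ) ≤ (1 + u⁻¹) ^ N' := one_le_pow₀ (by linarith)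
  rcases le_or_gt 1 u with hu1 | hu1
  · have h2 : u ^ (-N) ≤ 1 := Real.rpow_le_one_of_one_le_of_nonpos hu1 (by linarith)
    linarith
  · have hui : 1 ≤ u⁻¹ := (one_le_inv₀ hu).2 hu1.le
    have e : u ^ (-N) = u⁻¹ ^ N := by rw [Real.rpow_neg hu.le, Real.inv_rpow hu.le]
    have h2 : u⁻¹ ^ N ≤ u⁻¹ ^ (N' : ℝ) := Real.rpow_le_rpow_of_exponent_le hui hN'
    rw [Real.rpow_natCast] at h2
    have h4 : u⁻¹ ^ N' ≤ (1 + u⁻¹) ^ N' := pow_le_pow_left₀ hui0 (by linarith) N'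
    rw [e]
    linarith

/-- real exponent → natural exponent on a base `≥ 1`: `(1 + t)^{N} ≤ (1 + t)^{N₁}` for `t ≥ 0`, `N ≤ N₁`. [folklore] -/
theorem one_add_rpow_le_pow {t N : ℝ} (ht : 0 ≤ t) {N₁ : ℕ} (hN₁ : N ≤ N₁) : (1 + t) ^ N ≤ (1 + t) ^ N₁ := by
  have h := Real.rpow_le_rpow_of_exponent_le (x := 1 + t) (by linarith) hN₁
  rwa [Real.rpow_natCast] at h

end Real

/-! ## §3 The face: three-factor archimedean growth in block currency ⟹ the (D-loc) shape -/

section Face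

open NumberField NumberField.mixedEmbedding NumberField.InfinitePlace IsDedekindDomain
open Literature.NumberTheory.Automorphic Literature.NumberTheory.Automorphic.UnitaryGroup

variable (F E : Type) [Field F] [NumberField F] [Field E] [NumberField E] [Algebra F E] (c : E ≃ₐ[F] E) (N : ℕ) (J : Matrix (Fin N) (Fin N) E)
variable {S p : Type*} [Fintype S] [Fintype p] [DecidableEq p]

/-- **THREE-FACTOR ARCHIMEDEAN GROWTH IN BLOCK CURRENCY ⟹ THE (D-loc) SHAPE.**  Frame data BY VALUE as in ★ `decay_le_exp_neg_height` ∕ ★ G7-C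
`latticeSum_le_height` (complex places `w σ` fixed by `c ≠ 1`, `r : p ⊕ p ≃ Fin N`, frames `T σ, T σ⁻¹`, movers, one bound `M ≥ 1`, ANY block decomposition
`hdec : T σ · (h_∞)~_{w σ} · T σ⁻¹ = [y σ, b σ; 0, d σ] · κ σ`); growth data BY VALUE: a rate `cg > 0` and real exponents `Ng, N′g ≥ 0` (★ JUNCTION
`kFiniteSection_whittaker_holomorphy_growth`: `C e^{−cg·tr h′}(1 + tr h′)^{Ng}(1 + det h′^{−N′g})` at `h′_σ = y_σᴴ x_σ y_σ`, `tr h′_σ = Re tr(x_σ · y_σ y_σᴴ)`,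
`det h′_σ = Re det(x_σ · y_σ y_σᴴ)`, §1), target natural exponents `N₁ ≥ Ng·#S`, `N′₁ ≥ N′g`, and a comparison constant `K ≥ 1` for the TOP's size `τ`
(`τ ≤ Σ_σ Re tr x_σ ≤ K τ`).  CONCLUSION: `∃ C a c₁` (these data only) such that for every `h`, every block decomposition, every index `x : S → M_p(ℂ)` with all
`x σ ≻ 0` and every such `τ`:
  `∏_σ e^{−cg Re tr(x_σ y_σ y_σᴴ)} (1 + Re tr(x_σ y_σ y_σᴴ))^{Ng} (1 + (Re det(x_σ y_σ y_σᴴ))^{−N′g})`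
  `≤ C · ‖h‖^a · (e^{−c₁ ‖h‖^{−2} τ} · (1 + τ)^{N₁}) · ∏_σ (1 + (Re det x_σ)⁻¹)^{N′₁}`
— the archimedean half of ★ `K2LiuSiegelEisensteinKindWDecay.hdec_of_letters`' `hloc` (`a′ = 2`), the determinant defect left in block currency.
(i) decay: ★ `decay_le_exp_neg_height`'s road (`y yᴴ ⪰ ε(h)•1`, `ε(h)⁻¹ ≤ c_E² ‖h‖²`); (ii) polynomial: §1 `re_trace_mul_le_of_entry_le` + ★ `block_entry_bounds`;
(iii) determinant: §1 `re_det_mul_mul_conjTranspose` + ★ `rpow_neg_re_det_le` + §2. [cite: MoeglinWaldspurger1995, I.2.2, II.1.5] [cite: BorelJacquet1979, §1.2, §4.1]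
[cite: Shimura1997, §A3] -/
theorem archGrowth_le_heightDecay [NeZero N] [Nonempty p] (hc : c ≠ 1) (w : S → {w : InfinitePlace E // IsComplex w}) (hw : ∀ σ, c • (w σ).1 = (w σ).1)
    (r : p ⊕ p ≃ Fin N) (T Tinv : S → Matrix (p ⊕ p) (p ⊕ p) ℂ) (hT : ∀ σ, T σ * Tinv σ = 1) (hT' : ∀ σ, Tinv σ * T σ = 1)
    {M : ℝ} (hM : 1 ≤ M) (hTe : ∀ σ i j, ‖T σ i j‖ ≤ M) (hTe' : ∀ σ i j, ‖Tinv σ i j‖ ≤ M)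
    {cg : ℝ} (hcg : 0 < cg) {Ng N'g : ℝ} (hNg : 0 ≤ Ng) (hN'g : 0 ≤ N'g) {N₁ N'₁ : ℕ} (hN₁ : Ng * Fintype.card S ≤ N₁) (hN'₁ : N'g ≤ N'₁)
    {K : ℝ} (hK : 1 ≤ K) :
    ∃ C a c₁ : ℝ, 0 ≤ C ∧ 0 ≤ a ∧ 0 < c₁ ∧ ∀ (h : (adelicGroupData F E c N J).Adelic) (y b d : S → Matrix p p ℂ) (κ κ' : S → Matrix (p ⊕ p) (p ⊕ p) ℂ),
      (∀ σ, κ σ * κ' σ = 1) → (∀ σ, κ' σ * κ σ = 1) → (∀ σ i j, ‖κ σ i j‖ ≤ M) → (∀ σ i j, ‖κ' σ i j‖ ≤ M) →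
      (∀ σ, T σ * Matrix.reindex r.symm r.symm
          ((((archAt F E c N J (w σ) (hw σ) hc (archPart F E c N J h) : archLocal E N J (w σ)) : GL (Fin N) ℂ) : Matrix (Fin N) (Fin N) ℂ)) *
          Tinv σ = Matrix.fromBlocks (y σ) (b σ) 0 (d σ) * κ σ) →
      ∀ x : S → Matrix p p ℂ, (∀ σ, (x σ).PosDef) → ∀ τ : ℝ, τ ≤ ∑ σ, ((x σ).trace).re → ∑ σ, ((x σ).trace).re ≤ K * τ →
        ∏ σ, (Real.exp (-(cg * ((x σ * (y σ * (y σ)ᴴ)).trace).re)) * (1 + ((x σ * (y σ * (y σ)ᴴ)).trace).re) ^ Ng *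
            (1 + (((x σ * (y σ * (y σ)ᴴ)).det).re) ^ (-N'g))) ≤
          C * adelicHeightGL N E (adelicVal F E c N J h) ^ a *
            (Real.exp (-(c₁ * adelicHeightGL N E (adelicVal F E c N J h) ^ (-(2 : ℝ)) * τ)) * (1 + τ) ^ N₁) *
            ∏ σ, (1 + (((x σ).det).re)⁻¹) ^ N'₁ := by
  obtain ⟨c₀, hc₀, hfloor⟩ := exists_adelicHeightGL_floor E N
  -- constants (the frame part as in ★ G7-C `latticeSum_le_height` ∕ ★ `decay_le_exp_neg_height`)
  set cB : ℝ := (Fintype.card (p ⊕ p) : ℝ) ^ 3 * M ^ 3 with hcB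
  have hcB0 : 0 ≤ cB := by positivity
  set cE : ℝ := (Fintype.card p : ℝ) * (cB + c₀⁻¹) with hcE
  have hp1 : (1 : ℝ) ≤ Fintype.card p := by exact_mod_cast Fintype.card_pos
  have hcEpos : 0 < cE := by positivity
  -- (ii): `K₂ = c₀⁻² + |p|³ c_B²` (so that `1 + |p|³ c_B² ‖h‖² ≤ K₂ ‖h‖²`)
  set K₂ : ℝ := (c₀ ^ 2)⁻¹ + (Fintype.card p : ℝ) ^ 3 * cB ^ 2 with hK₂
  have hK₂0 : 0 ≤ K₂ := by positivity
  -- (iii): `A₃ = 2|p|N′g`, `K₃ = ((|p|! c_B^{|p|})²)^{N′g}`, `K₄ = c₀^{−A₃} + K₃` (so that `1 + K₃ ‖h‖^{A₃} ≤ K₄ ‖h‖^{A₃}`)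
  set A₃ : ℝ := 2 * (Fintype.card p : ℝ) * N'g with hA₃
  have hA₃0 : 0 ≤ A₃ := by positivity
  set K₃ : ℝ := ((((Fintype.card p).factorial : ℝ) * cB ^ Fintype.card p) ^ 2) ^ N'g with hK₃
  have hK₃0 : 0 ≤ K₃ := by positivity
  set K₄ : ℝ := c₀ ^ (-A₃) + K₃ with hK₄
  have hK₄0 : 0 ≤ K₄ := add_nonneg (Real.rpow_nonneg hc₀.le _) hK₃0
  refine ⟨K₂ ^ N₁ * K ^ N₁ * (2 * K₄) ^ Fintype.card S, 2 * (N₁ : ℝ) + A₃ * Fintype.card S, cg * (cE ^ 2)⁻¹, by positivity, by positivity,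
    by positivity, fun h y b d κ κ' hκ hκ' hκe hκe' hdec x hx τ hτ hτK => ?_⟩
  set H : ℝ := adelicHeightGL N E (adelicVal F E c N J h) with hH
  have hHc : c₀ ≤ H := hfloor _
  have hH0 : 0 < H := lt_of_lt_of_le hc₀ hHc
  have hM0 : 0 ≤ M := zero_le_one.trans hM
  -- per place: entries of `y σ`, `(y σ)⁻¹` (★ `block_entry_bounds`)
  have hblk : ∀ σ, (∀ i j, ‖y σ i j‖ ≤ cB * H) ∧ (∀ i j, ‖(y σ)⁻¹ i j‖ ≤ cB * H) ∧ y σ * (y σ)⁻¹ = 1 := by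
    intro σ
    have hg := norm_archAt_archPart_apply_le F E c N J (w σ) (hw σ) hc h
    have hmul : ((((archAt F E c N J (w σ) (hw σ) hc (archPart F E c N J h) : archLocal E N J (w σ)) : GL (Fin N) ℂ) : Matrix (Fin N) (Fin N) ℂ)) *
        ((((archAt F E c N J (w σ) (hw σ) hc (archPart F E c N J h))⁻¹ : archLocal E N J (w σ)) : GL (Fin N) ℂ) : Matrix (Fin N) (Fin N) ℂ) = 1 := by
      rw [Subgroup.coe_inv, Matrix.coe_units_inv, Matrix.mul_nonsing_inv _ (Matrix.isUnits_det_units _)]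
    exact block_entry_bounds r (hT σ) (hT' σ) (hκ σ) (hκ' σ) hM0 (hTe σ) (hTe' σ) (hκe σ) (hκe' σ) hmul hH0.le
      (fun i j => (hg i j).1) (fun i j => (hg i j).2) (hdec σ)
  -- sizes: `u σ = Re tr x_σ ≥ 0`, `t σ = Re tr(x_σ · y_σ y_σᴴ) ≥ 0`, `τ ≥ 0`
  have hu0 : ∀ σ, 0 ≤ ((x σ).trace).re := fun σ => re_trace_nonneg_of_posSemidef (hx σ).posSemidef
  have hsum0 : 0 ≤ ∑ σ, ((x σ).trace).re := Finset.sum_nonneg fun σ _ => hu0 σ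
  have ht0 : ∀ σ, 0 ≤ ((x σ * (y σ * (y σ)ᴴ)).trace).re := fun σ =>
    re_trace_mul_nonneg (hx σ).posSemidef (Matrix.posSemidef_self_mul_conjTranspose (y σ))
  have hK0 : 0 < K := lt_of_lt_of_le one_pos hK
  have hτ0 : 0 ≤ τ := (mul_nonneg_iff_of_pos_left hK0).1 (hsum0.trans hτK)
  /- FACTOR (i): the decay, at rate `cg` (★ `decay_le_exp_neg_height`'s road) -/
  have hdecay : ∏ σ, Real.exp (-(cg * ((x σ * (y σ * (y σ)ᴴ)).trace).re)) ≤ Real.exp (-(cg * (cE ^ 2)⁻¹ * H ^ (-(2 : ℝ)) * τ)) := by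
    set R : ℝ := cB * H + 1 with hR
    set ε : ℝ := ((((Fintype.card p : ℝ) * R) ^ 2)⁻¹) with hε
    have hR0 : 0 < R := by rw [hR]; nlinarith [mul_nonneg hcB0 hH0.le]
    have hε0 : 0 < ε := by positivity
    have hg : ∀ σ, (y σ * (y σ)ᴴ - (ε : ℂ) • (1 : Matrix p p ℂ)).PosSemidef := fun σ =>
      posSemidef_mul_conjTranspose_sub_smul (hblk σ).2.2 fun i j => ((hblk σ).2.1 i j).trans (by rw [hR]; linarith)
    have hεu : ∀ σ, ε * ((x σ).trace).re ≤ ((x σ * (y σ * (y σ)ᴴ)).trace).re := fun σ =>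
      mul_re_trace_le_re_trace_mul (hx σ).posSemidef (hg σ)
    -- `ε ≥ c_E⁻² ‖h‖⁻²`
    have hinv : ε⁻¹ ≤ cE ^ 2 * H ^ 2 := by
      rw [hε, inv_inv]
      have h1 : (Fintype.card p : ℝ) * R ≤ cE * H := by
        rw [hcE, hR]
        have h3 : 1 ≤ c₀⁻¹ * H := by rw [inv_mul_eq_div, le_div_iff₀ hc₀]; linarith
        have h2 : cB * H + 1 ≤ (cB + c₀⁻¹) * H := by nlinarith
        calc (Fintype.card p : ℝ) * (cB * H + 1) ≤ (Fintype.card p : ℝ) * ((cB + c₀⁻¹) * H) :=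
              mul_le_mul_of_nonneg_left h2 (Nat.cast_nonneg _)
          _ = (Fintype.card p : ℝ) * (cB + c₀⁻¹) * H := by ring
      calc ((Fintype.card p : ℝ) * R) ^ 2 ≤ (cE * H) ^ 2 := pow_le_pow_left₀ (by positivity) h1 2
        _ = cE ^ 2 * H ^ 2 := by ring
    have hεge : (cE ^ 2)⁻¹ * H ^ (-(2 : ℝ)) ≤ ε := by
      have h1 : (cE ^ 2 * H ^ 2)⁻¹ ≤ ε := inv_le_of_inv_le₀ hε0 hinv
      rw [Real.rpow_neg hH0.le, ← mul_inv, show H ^ (2 : ℝ) = H ^ 2 by norm_cast]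
      exact h1
    have hkey : (cE ^ 2)⁻¹ * H ^ (-(2 : ℝ)) * τ ≤ ε * ∑ σ, ((x σ).trace).re := mul_le_mul hεge hτ hτ0 hε0.le
    rw [← Real.exp_sum, Real.exp_le_exp]
    calc ∑ σ, -(cg * ((x σ * (y σ * (y σ)ᴴ)).trace).re) ≤ ∑ σ, -(cg * (ε * ((x σ).trace).re)) :=
          Finset.sum_le_sum fun σ _ => neg_le_neg (mul_le_mul_of_nonneg_left (hεu σ) hcg.le)
      _ = -(cg * (ε * ∑ σ, ((x σ).trace).re)) := by rw [Finset.sum_neg_distrib, ← Finset.mul_sum, ← Finset.mul_sum]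
      _ ≤ -(cg * ((cE ^ 2)⁻¹ * H ^ (-(2 : ℝ)) * τ)) := neg_le_neg (mul_le_mul_of_nonneg_left hkey hcg.le)
      _ = -(cg * (cE ^ 2)⁻¹ * H ^ (-(2 : ℝ)) * τ) := by ring
  /- FACTOR (ii): the polynomial factor, `(1 + t σ)^{Ng} ≤ B^{Ng}` with `B = K₂ ‖h‖² (1 + Σ u) ≥ 1` -/
  have hpoly : ∏ σ, (1 + ((x σ * (y σ * (y σ)ᴴ)).trace).re) ^ Ng ≤ K₂ ^ N₁ * K ^ N₁ * (H ^ (2 * (N₁ : ℝ)) * (1 + τ) ^ N₁) := by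
    have ht : ∀ σ, ((x σ * (y σ * (y σ)ᴴ)).trace).re ≤ (Fintype.card p : ℝ) ^ 3 * (cB * H) ^ 2 * ((x σ).trace).re := fun σ =>
      re_trace_mul_le_of_entry_le (hx σ) (by positivity) (hblk σ).1
    have hK₂H : 1 ≤ (c₀ ^ 2)⁻¹ * H ^ 2 := by
      rw [inv_mul_eq_div, one_le_div (by positivity)]
      exact pow_le_pow_left₀ hc₀.le hHc 2
    set B : ℝ := K₂ * H ^ 2 * (1 + ∑ σ, ((x σ).trace).re) with hB
    have hcoef : 0 ≤ (Fintype.card p : ℝ) ^ 3 * cB ^ 2 * H ^ 2 := by positivity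
    have hK₂H1 : 1 ≤ K₂ * H ^ 2 := by
      rw [hK₂]
      linarith
    have hB1 : 1 ≤ B := one_le_mul_of_one_le_of_one_le hK₂H1 (by linarith)
    have hB0 : 0 ≤ B := zero_le_one.trans hB1
    have h1t : ∀ σ, 1 + ((x σ * (y σ * (y σ)ᴴ)).trace).re ≤ B := by
      intro σ
      have h1 := ht σ
      have hu := hu0 σ
      have hus : ((x σ).trace).re ≤ ∑ σ', ((x σ').trace).re := Finset.single_le_sum (fun σ' _ => hu0 σ') (Finset.mem_univ σ)
      have hm1 : (Fintype.card p : ℝ) ^ 3 * cB ^ 2 * H ^ 2 * ((x σ).trace).re ≤ (Fintype.card p : ℝ) ^ 3 * cB ^ 2 * H ^ 2 * ∑ σ', ((x σ').trace).re :=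
        mul_le_mul_of_nonneg_left hus hcoef
      have hm2 : 0 ≤ (c₀ ^ 2)⁻¹ * H ^ 2 * ∑ σ', ((x σ').trace).re := mul_nonneg (by positivity) hsum0
      have h1' : ((x σ * (y σ * (y σ)ᴴ)).trace).re ≤ (Fintype.card p : ℝ) ^ 3 * cB ^ 2 * H ^ 2 * ((x σ).trace).re := by
        calc ((x σ * (y σ * (y σ)ᴴ)).trace).re ≤ (Fintype.card p : ℝ) ^ 3 * (cB * H) ^ 2 * ((x σ).trace).re := h1
          _ = (Fintype.card p : ℝ) ^ 3 * cB ^ 2 * H ^ 2 * ((x σ).trace).re := by ring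
      rw [hB, hK₂]
      linarith
    calc ∏ σ, (1 + ((x σ * (y σ * (y σ)ᴴ)).trace).re) ^ Ng ≤ ∏ _σ : S, B ^ Ng :=
          Finset.prod_le_prod (fun σ _ => Real.rpow_nonneg (by linarith [ht0 σ]) _) fun σ _ => Real.rpow_le_rpow (by linarith [ht0 σ]) (h1t σ) hNg
      _ = B ^ (Ng * Fintype.card S) := by rw [Finset.prod_const, Finset.card_univ, ← Real.rpow_natCast, ← Real.rpow_mul hB0]
      _ ≤ B ^ (N₁ : ℝ) := Real.rpow_le_rpow_of_exponent_le hB1 hN₁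
      _ = (K₂ * H ^ 2) ^ N₁ * (1 + ∑ σ, ((x σ).trace).re) ^ N₁ := by rw [Real.rpow_natCast, hB, mul_pow]
      _ ≤ (K₂ * H ^ 2) ^ N₁ * (K * (1 + τ)) ^ N₁ :=
          mul_le_mul_of_nonneg_left (pow_le_pow_left₀ (by linarith) (by linarith) N₁) (pow_nonneg (by positivity) _)
      _ = K₂ ^ N₁ * K ^ N₁ * ((H ^ 2) ^ N₁ * (1 + τ) ^ N₁) := by rw [mul_pow, mul_pow]; ring
      _ = K₂ ^ N₁ * K ^ N₁ * (H ^ (2 * (N₁ : ℝ)) * (1 + τ) ^ N₁) := by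
          rw [← Real.rpow_natCast (H ^ 2) N₁, ← Real.rpow_natCast H 2, ← Real.rpow_mul hH0.le]
          norm_num
  /- FACTOR (iii): the determinant factor, per place `1 + (Re det(x y yᴴ))^{−N′g} ≤ (2 K₄ ‖h‖^{A₃}) (1 + (Re det x)⁻¹)^{N′₁}` -/
  have h3 : 1 ≤ c₀ ^ (-A₃) * H ^ A₃ := by
    rw [Real.rpow_neg hc₀.le, inv_mul_eq_div, one_le_div (Real.rpow_pos_of_pos hc₀ _)]
    exact Real.rpow_le_rpow hc₀.le hHc hA₃0
  have hdetσ : ∀ σ, 1 + (((x σ * (y σ * (y σ)ᴴ)).det).re) ^ (-N'g) ≤ (2 * K₄ * H ^ A₃) * (1 + (((x σ).det).re)⁻¹) ^ N'₁ := by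
    intro σ
    obtain ⟨hD0, -⟩ := re_det_pos_of_posDef (hx σ)
    have hv : ((y σ * (y σ)ᴴ).det).re = ‖(y σ).det‖ ^ 2 := re_det_mul_conjTranspose (y σ)
    have hv0 : 0 ≤ ‖(y σ).det‖ ^ 2 := sq_nonneg _
    rw [re_det_mul_mul_conjTranspose]
    refine (one_add_mul_rpow_neg_le_mul hD0.le hv0 N'g).trans ?_
    have hA : 1 + (((x σ).det).re) ^ (-N'g) ≤ 2 * (1 + (((x σ).det).re)⁻¹) ^ N'₁ := one_add_rpow_neg_le_two_mul_pow hD0 hN'g hN'₁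
    have hBd : 1 + (‖(y σ).det‖ ^ 2) ^ (-N'g) ≤ K₄ * H ^ A₃ := by
      rw [← hv]
      have h1 := rpow_neg_re_det_le (hblk σ).2.2 (hblk σ).1 (hblk σ).2.1 N'g
      rw [abs_of_nonneg hN'g] at h1
      have h2 : ((((Fintype.card p).factorial : ℝ) * (cB * H) ^ Fintype.card p) ^ 2) ^ N'g = K₃ * H ^ A₃ := by
        have hsplit : ((((Fintype.card p).factorial : ℝ) * (cB * H) ^ Fintype.card p) ^ 2) =
            ((((Fintype.card p).factorial : ℝ) * cB ^ Fintype.card p) ^ 2) * (H ^ 2) ^ Fintype.card p := by ring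
        rw [hsplit, Real.mul_rpow (by positivity) (by positivity), hK₃, hA₃]
        congr 1
        rw [← Real.rpow_natCast (H ^ 2) (Fintype.card p), ← Real.rpow_natCast H 2, ← Real.rpow_mul hH0.le, ← Real.rpow_mul hH0.le]
        norm_num
      rw [h2] at h1
      calc 1 + (((y σ * (y σ)ᴴ).det).re) ^ (-N'g) ≤ c₀ ^ (-A₃) * H ^ A₃ + K₃ * H ^ A₃ := add_le_add h3 h1
        _ = K₄ * H ^ A₃ := by rw [hK₄]; ring
    have hA0 : 0 ≤ 1 + (‖(y σ).det‖ ^ 2) ^ (-N'g) := by positivity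
    calc (1 + (((x σ).det).re) ^ (-N'g)) * (1 + (‖(y σ).det‖ ^ 2) ^ (-N'g)) ≤ (2 * (1 + (((x σ).det).re)⁻¹) ^ N'₁) * (K₄ * H ^ A₃) :=
          mul_le_mul hA hBd hA0 (by positivity)
      _ = (2 * K₄ * H ^ A₃) * (1 + (((x σ).det).re)⁻¹) ^ N'₁ := by ring
  have hQ0 : ∀ σ, 0 ≤ 1 + (((x σ * (y σ * (y σ)ᴴ)).det).re) ^ (-N'g) := fun σ => by
    rw [re_det_mul_mul_conjTranspose]
    exact add_nonneg zero_le_one (Real.rpow_nonneg (mul_nonneg (re_det_pos_of_posDef (hx σ)).1.le (sq_nonneg _)) _)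
  have hdet : ∏ σ, (1 + (((x σ * (y σ * (y σ)ᴴ)).det).re) ^ (-N'g)) ≤
      (2 * K₄) ^ Fintype.card S * H ^ (A₃ * Fintype.card S) * ∏ σ, (1 + (((x σ).det).re)⁻¹) ^ N'₁ := by
    calc ∏ σ, (1 + (((x σ * (y σ * (y σ)ᴴ)).det).re) ^ (-N'g)) ≤ ∏ σ, ((2 * K₄ * H ^ A₃) * (1 + (((x σ).det).re)⁻¹) ^ N'₁) :=
          Finset.prod_le_prod (fun σ _ => hQ0 σ) fun σ _ => hdetσ σ
      _ = (2 * K₄ * H ^ A₃) ^ Fintype.card S * ∏ σ, (1 + (((x σ).det).re)⁻¹) ^ N'₁ := by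
          rw [Finset.prod_mul_distrib, Finset.prod_const, Finset.card_univ]
      _ = (2 * K₄) ^ Fintype.card S * H ^ (A₃ * Fintype.card S) * ∏ σ, (1 + (((x σ).det).re)⁻¹) ^ N'₁ := by
          rw [mul_pow, ← Real.rpow_natCast (H ^ A₃) (Fintype.card S), ← Real.rpow_mul hH0.le]
  /- ASSEMBLY -/
  have hP0 : 0 ≤ ∏ σ, (1 + ((x σ * (y σ * (y σ)ᴴ)).trace).re) ^ Ng := Finset.prod_nonneg fun σ _ => Real.rpow_nonneg (by linarith [ht0 σ]) _
  have hQ0' : 0 ≤ ∏ σ, (1 + (((x σ * (y σ * (y σ)ᴴ)).det).re) ^ (-N'g)) := Finset.prod_nonneg fun σ _ => hQ0 σ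
  have hX₁0 : 0 ≤ Real.exp (-(cg * (cE ^ 2)⁻¹ * H ^ (-(2 : ℝ)) * τ)) := (Real.exp_pos _).le
  have hX₂0 : 0 ≤ K₂ ^ N₁ * K ^ N₁ * (H ^ (2 * (N₁ : ℝ)) * (1 + τ) ^ N₁) := by positivity
  have hHa : H ^ (2 * (N₁ : ℝ) + A₃ * Fintype.card S) = H ^ (2 * (N₁ : ℝ)) * H ^ (A₃ * Fintype.card S) := Real.rpow_add hH0 _ _
  calc ∏ σ, (Real.exp (-(cg * ((x σ * (y σ * (y σ)ᴴ)).trace).re)) * (1 + ((x σ * (y σ * (y σ)ᴴ)).trace).re) ^ Ng *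
          (1 + (((x σ * (y σ * (y σ)ᴴ)).det).re) ^ (-N'g)))
        = (∏ σ, Real.exp (-(cg * ((x σ * (y σ * (y σ)ᴴ)).trace).re))) * (∏ σ, (1 + ((x σ * (y σ * (y σ)ᴴ)).trace).re) ^ Ng) *
          ∏ σ, (1 + (((x σ * (y σ * (y σ)ᴴ)).det).re) ^ (-N'g)) := by rw [Finset.prod_mul_distrib, Finset.prod_mul_distrib]
    _ ≤ Real.exp (-(cg * (cE ^ 2)⁻¹ * H ^ (-(2 : ℝ)) * τ)) * (K₂ ^ N₁ * K ^ N₁ * (H ^ (2 * (N₁ : ℝ)) * (1 + τ) ^ N₁)) *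
          ((2 * K₄) ^ Fintype.card S * H ^ (A₃ * Fintype.card S) * ∏ σ, (1 + (((x σ).det).re)⁻¹) ^ N'₁) :=
        mul_le_mul (mul_le_mul hdecay hpoly hP0 hX₁0) hdet hQ0' (mul_nonneg hX₁0 hX₂0)
    _ = K₂ ^ N₁ * K ^ N₁ * (2 * K₄) ^ Fintype.card S * H ^ (2 * (N₁ : ℝ) + A₃ * Fintype.card S) *
          (Real.exp (-(cg * (cE ^ 2)⁻¹ * H ^ (-(2 : ℝ)) * τ)) * (1 + τ) ^ N₁) * ∏ σ, (1 + (((x σ).det).re)⁻¹) ^ N'₁ := by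
        rw [hHa]; ring

end Face

end Summit.HodgeConjecture.HodgeConjecture.Cruxes.HLiu418.K2LiuSiegelEisensteinKindWArchBlock

end
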